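import Literature.NumberTheory.Transcendental.KZCubeRationalMoves

/-!
# Crux `ReductionRigidity` (stmt-KontsevichZagierPeriods-3407), line `Sketch` (Padé box island):
# stub `stub_lineBase`

The pure-power layer of the dimension-one reduction on the box sector
`{[□², xᵃyᵇ/(N − xy)^m], [□¹, x^c/(N − x)^m], [pt, q]}` (`□ = [0,1]`, `N ≥ 2`) of the
Kontsevich–Zagier calculus of moves (`KZ.relations`, `KZCalculus.lean`), line `Sketch` (the
`w = 2` Padé box island): for `q ∈ ℚ` and `m ∈ ℕ`, EVERY representation `r = [□¹, q/(N − x)^m]`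
is congruent modulo `KZ.relations` to the sum of the two normal forms `[□¹, β/(N − x)] + [pt, γ]`
with RATIONAL `β, γ`:

* `m = 0`: the integrand is the constant `q`; ignoring the variable (`KZ.RFun.rel_lift`, a Stokes
  move with primitive `x · q`) gives `[□¹, q] ≡ [pt, q]`, so `β = 0`, `γ = q`;
* `m = 1`: already a normal form, `β = q`, `γ = 0`;
* `m = k + 2`: Newton–Leibniz (Ayoub's Stokes relation `KZ.RFun.stokes`) with the RATIONAL primitive
  `T = c/(N − x)^{k+1}`, `c = q/(k+1)`, regular on the closed interval because `N − x ≥ 1` there: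
  `∂ₓT = q/(N − x)^{k+2}`, so `[□¹, q/(N − x)^{k+2}] ≡ [pt, T(1)] − [pt, T(0)] ≡ [pt, γ]` with
  `γ = c/(N − 1)^{k+1} − c/N^{k+1} ∈ ℚ`, and `β = 0`.

All moves are instances of the side-condition-free `KZ.RFun` API (`KZCubeRational.lean`,
`KZCubeRationalMoves.lean`); the arbitrary representation `r` of the statement is bridged to a tame
cube representation by integrand congruence (`KZ.of_sub_of_mem_relations_of_eqOn`).  This file feeds
the lead's induction `lineReduction` (on the exponent `c`) of the line; it introduces no definitions
and no named facts.

## References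

* M. Kontsevich, D. Zagier, *Periods* (2001), §1.1–1.2. [cite: KontsevichZagier2001, §1.2]
* J. Ayoub, *Periods and the conjectures of Grothendieck and Kontsevich–Zagier*, EMS Newsletter 91
  (2014), §2.2, Def. 10. [cite: Ayoub2014, Def. 10]
-/

noncomputable section

open MeasureTheory Set MvPolynomial

namespace Summit.KontsevichZagierPeriods.HermiteRigidity.ReductionRigidity

open Literature.NumberTheory.Transcendental
open Literature.NumberTheory.Transcendental.KZ

/-! ## Regularity of the line denominators on the closed interval -/

/-- On the closed unit interval, `N − x ≥ 1` for `N ≥ 2`. [folklore] -/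
theorem lineBase_one_le_sub {N : ℕ} (hN : 2 ≤ N) {x : Fin 1 → ℝ} (hx : x ∈ cube 1) :
    (1 : ℝ) ≤ (N : ℝ) - x 0 := by
  have h2 : (2 : ℝ) ≤ (N : ℝ) := by exact_mod_cast hN
  have h1 := (hx 0).2
  linarith

/-- The line denominator `(N − x)^m` does not vanish on the closed interval (`N ≥ 2`). [folklore] -/
theorem lineBase_den_ne {N : ℕ} (hN : 2 ≤ N) (m : ℕ) :
    ∀ x ∈ cube 1, aeval x ((C (N : ℚ) - X 0) ^ m : MvPolynomial (Fin 1) ℚ) ≠ 0 := by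
  intro x hx
  have h := lineBase_one_le_sub hN hx
  simp only [map_pow, map_sub, aeval_C, aeval_X, eq_ratCast, Rat.cast_natCast]
  exact pow_ne_zero _ (by linarith)

/-- The values of the pure-power line generator `c/(N − x)^m` as a regular rational function on the
closed interval. [cite: KontsevichZagier2001, §1.1] -/
theorem lineBase_fn_gen {N : ℕ} (hN : 2 ≤ N) (c : ℚ) (m : ℕ) (x : Fin 1 → ℝ) :
    (⟨C c, (C (N : ℚ) - X 0) ^ m, lineBase_den_ne hN m⟩ : RFun 1).fn x =
      (c : ℝ) / ((N : ℝ) - x 0) ^ m := by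
  simp only [RFun.fn, map_pow, map_sub, aeval_C, aeval_X, eq_ratCast, Rat.cast_natCast]

/-! ## The derivative of the rational primitive -/

/-- `∂ₓ (N − x)^{k+1} = −(k+1) (N − x)^k` in `ℚ[x]`. [folklore] -/
theorem lineBase_pderiv_den (N : ℚ) (k : ℕ) :
    pderiv (Fin.last 0) ((C N - X 0) ^ (k + 1) : MvPolynomial (Fin 1) ℚ) =
      -((k + 1 : ℕ) : MvPolynomial (Fin 1) ℚ) * (C N - X 0) ^ k := by
  have h0 : (Fin.last 0 : Fin 1) = 0 := rfl
  rw [Derivation.leibniz_pow, Nat.add_sub_cancel, map_sub, pderiv_C, h0, pderiv_X_self, zero_sub,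
    smul_eq_mul, mul_neg, mul_one, smul_neg, nsmul_eq_mul, neg_mul]

/-- The derivative of the rational primitive `T = c/(N − x)^{k+1}` on the closed interval:
`∂ₓT = c(k+1)/(N − x)^{k+2}` (quotient rule, `KZ.RFun.dlast`). [folklore] -/
theorem lineBase_dlast_fn {N : ℕ} (hN : 2 ≤ N) (c : ℚ) (k : ℕ) {x : Fin 1 → ℝ} (hx : x ∈ cube 1) :
    (RFun.dlast (⟨C c, (C (N : ℚ) - X 0) ^ (k + 1), lineBase_den_ne hN (k + 1)⟩ : RFun 1)).fn x =
      (c : ℝ) * (k + 1) / ((N : ℝ) - x 0) ^ (k + 2) := by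
  have hD : (N : ℝ) - x 0 ≠ 0 := by
    have h := lineBase_one_le_sub hN hx
    intro h0
    rw [h0] at h
    exact absurd h (by norm_num)
  simp only [RFun.fn, RFun.dlast]
  rw [lineBase_pderiv_den, pderiv_C, zero_mul, zero_sub]
  simp only [map_neg, map_mul, map_pow, map_sub, map_natCast, aeval_C, aeval_X, eq_ratCast]
  push_cast
  field_simp
  ring

/-! ## Bridging an arbitrary representation to a tame cube representation -/

/-- An arbitrary representation on the closed cube carrying the values of a regular rational
function is congruent to its tame cube representation (integrand congruence).
[cite: KontsevichZagier2001, §1.2 rule (1)] -/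
theorem lineBase_bridge {n : ℕ} {r : IntegralRep n} {f : (Fin n → ℝ) → ℝ} (hrd : r.domain = cube n)
    (hri : EqOn r.integrand f (cube n)) (T : RFun n) (hT : ∀ x ∈ cube n, T.fn x = f x) :
    KZ.of r - KZ.of T.rep ∈ KZ.relations :=
  of_sub_of_mem_relations_of_eqOn (by rw [hrd]; rfl) fun x hx => by
    rw [hrd] at hx
    rw [hri hx, RFun.rep_integrand, hT x hx]

/-! ## The three layers `m = 0`, `m = 1`, `m ≥ 2` -/

/-- Layer `m = 0`: `[□¹, q] ≡ [□¹, 0/(N − x)] + [pt, q]` — ignoring the variable is a relation.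
[cite: KontsevichZagier2001, §1.2 rule (3)] -/
theorem lineBase_pow_zero (N : ℕ) (q : ℚ) (r : IntegralRep 1) (hrd : r.domain = cube 1)
    (hri : EqOn r.integrand (fun p => (q : ℝ) / ((N : ℝ) - p 0) ^ 0) (cube 1)) :
    ∃ (β γ : ℚ) (s₁ : IntegralRep 1) (s₀ : IntegralRep 0),
      s₁.domain = cube 1 ∧ EqOn s₁.integrand (fun p => (β : ℝ) / ((N : ℝ) - p 0)) (cube 1) ∧
      s₀.domain = cube 0 ∧ EqOn s₀.integrand (fun _ => (γ : ℝ)) (cube 0) ∧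
      KZ.of r - (KZ.of s₁ + KZ.of s₀) ∈ KZ.relations := by
  -- `r ≡ [□¹, q] = [lift (const q)] ≡ [pt, q]`; the line normal form with `β = 0` is a relation
  have h1 : KZ.of r - KZ.of (RFun.const q : RFun 0).lift.rep ∈ KZ.relations :=
    lineBase_bridge hrd hri (RFun.const q : RFun 0).lift fun x _ => by
      rw [RFun.fn_lift, RFun.fn_const, pow_zero, div_one]
  have h2 := RFun.rel_lift (RFun.const q : RFun 0)
  have h3 : KZ.of (RFun.const 0 : RFun 1).rep ∈ KZ.relations :=
    RFun.rel_of_eqOn_zero fun x _ => by rw [RFun.fn_const, Rat.cast_zero]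
  refine ⟨0, q, (RFun.const 0 : RFun 1).rep, (RFun.const q : RFun 0).rep, rfl, fun x _ => ?_, rfl,
    fun x _ => ?_, ?_⟩
  · show (RFun.const 0 : RFun 1).fn x = ((0 : ℚ) : ℝ) / ((N : ℝ) - x 0)
    rw [RFun.fn_const, Rat.cast_zero, zero_div]
  · show (RFun.const q : RFun 0).fn x = (q : ℝ)
    rw [RFun.fn_const]
  · have : KZ.of r - (KZ.of (RFun.const 0 : RFun 1).rep + KZ.of (RFun.const q : RFun 0).rep) =
        (KZ.of r - KZ.of (RFun.const q : RFun 0).lift.rep)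
          + (KZ.of (RFun.const q : RFun 0).lift.rep - KZ.of (RFun.const q : RFun 0).rep)
          - KZ.of (RFun.const 0 : RFun 1).rep := by abel
    rw [this]
    exact KZ.relations.sub_mem (KZ.relations.add_mem h1 h2) h3

/-- Layer `m = 1`: `[□¹, q/(N − x)]` is already a line normal form (`β = q`, `γ = 0`).
[cite: KontsevichZagier2001, §1.2 rule (1)] -/
theorem lineBase_pow_one {N : ℕ} (hN : 2 ≤ N) (q : ℚ) (r : IntegralRep 1) (hrd : r.domain = cube 1)
    (hri : EqOn r.integrand (fun p => (q : ℝ) / ((N : ℝ) - p 0) ^ 1) (cube 1)) :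
    ∃ (β γ : ℚ) (s₁ : IntegralRep 1) (s₀ : IntegralRep 0),
      s₁.domain = cube 1 ∧ EqOn s₁.integrand (fun p => (β : ℝ) / ((N : ℝ) - p 0)) (cube 1) ∧
      s₀.domain = cube 0 ∧ EqOn s₀.integrand (fun _ => (γ : ℝ)) (cube 0) ∧
      KZ.of r - (KZ.of s₁ + KZ.of s₀) ∈ KZ.relations := by
  obtain ⟨G, hG⟩ : ∃ G : RFun 1, ∀ x, G.fn x = (q : ℝ) / ((N : ℝ) - x 0) ^ 1 :=
    ⟨_, lineBase_fn_gen hN q 1⟩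
  have h1 : KZ.of r - KZ.of G.rep ∈ KZ.relations := lineBase_bridge hrd hri G fun x _ => hG x
  have h3 : KZ.of (RFun.const 0 : RFun 0).rep ∈ KZ.relations :=
    RFun.rel_of_eqOn_zero fun x _ => by rw [RFun.fn_const, Rat.cast_zero]
  refine ⟨q, 0, G.rep, (RFun.const 0 : RFun 0).rep, rfl, fun x _ => ?_, rfl, fun x _ => ?_, ?_⟩
  · show G.fn x = (q : ℝ) / ((N : ℝ) - x 0)
    rw [hG, pow_one]
  · show (RFun.const 0 : RFun 0).fn x = ((0 : ℚ) : ℝ)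
    rw [RFun.fn_const]
  · have : KZ.of r - (KZ.of G.rep + KZ.of (RFun.const 0 : RFun 0).rep) =
        (KZ.of r - KZ.of G.rep) - KZ.of (RFun.const 0 : RFun 0).rep := by abel
    rw [this]
    exact KZ.relations.sub_mem h1 h3

/-- Layer `m = k + 2`: Newton–Leibniz with the rational primitive `T = c/(N − x)^{k+1}`,
`c = q/(k+1)`: `[□¹, q/(N − x)^{k+2}] = [∂ₓT] ≡ [T(1)] − [T(0)] ≡ [pt, c/(N−1)^{k+1} − c/N^{k+1}]`,
plus the zero line normal form. [cite: Ayoub2014, Def. 10] -/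
theorem lineBase_pow_add_two {N : ℕ} (hN : 2 ≤ N) (q : ℚ) (k : ℕ) (r : IntegralRep 1)
    (hrd : r.domain = cube 1)
    (hri : EqOn r.integrand (fun p => (q : ℝ) / ((N : ℝ) - p 0) ^ (k + 2)) (cube 1)) :
    ∃ (β γ : ℚ) (s₁ : IntegralRep 1) (s₀ : IntegralRep 0),
      s₁.domain = cube 1 ∧ EqOn s₁.integrand (fun p => (β : ℝ) / ((N : ℝ) - p 0)) (cube 1) ∧
      s₀.domain = cube 0 ∧ EqOn s₀.integrand (fun _ => (γ : ℝ)) (cube 0) ∧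
      KZ.of r - (KZ.of s₁ + KZ.of s₀) ∈ KZ.relations := by
  -- the primitive `T`, its values and its derivative on the closed interval
  obtain ⟨T, hT, hTd⟩ : ∃ T : RFun 1,
      (∀ x, T.fn x = ((q / (k + 1) : ℚ) : ℝ) / ((N : ℝ) - x 0) ^ (k + 1)) ∧
      ∀ x ∈ cube 1, T.dlast.fn x = ((q / (k + 1) : ℚ) : ℝ) * (k + 1) / ((N : ℝ) - x 0) ^ (k + 2) :=
    ⟨_, lineBase_fn_gen hN (q / (k + 1)) (k + 1),
      fun x hx => lineBase_dlast_fn hN (q / (k + 1)) k hx⟩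
  -- Stokes: `[∂ₓT] ≡ [T(·,1)] − [T(·,0)]`
  have hst := RFun.stokes T
  -- `r ≡ [∂ₓT]`
  have h1 : KZ.of r - KZ.of T.dlast.rep ∈ KZ.relations :=
    lineBase_bridge hrd hri T.dlast fun x hx => by
      rw [hTd x hx]
      have hk : (k : ℝ) + 1 ≠ 0 := by positivity
      push_cast
      rw [div_mul_cancel₀ _ hk]
  -- the two faces merge into one rational constant
  have h2 := RFun.rel_sub (T.face 1 ⟨zero_le_one, le_rfl⟩) (T.face 0 ⟨le_rfl, zero_le_one⟩)
  have h3 : KZ.of ((T.face 1 ⟨zero_le_one, le_rfl⟩).sub (T.face 0 ⟨le_rfl, zero_le_one⟩)).rep -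
      KZ.of (RFun.const (q / (k + 1) / ((N : ℚ) - 1) ^ (k + 1) - q / (k + 1) / (N : ℚ) ^ (k + 1)) :
        RFun 0).rep ∈ KZ.relations :=
    RFun.rel_of_eqOn fun x hx => by
      rw [RFun.fn_sub hx, RFun.fn_face, RFun.fn_face, hT, hT, RFun.fn_const, Fin.snoc_zero,
        Fin.snoc_zero]
      push_cast
      ring
  -- the zero line normal form is a relation
  have h4 : KZ.of (RFun.const 0 : RFun 1).rep ∈ KZ.relations :=
    RFun.rel_of_eqOn_zero fun x _ => by rw [RFun.fn_const, Rat.cast_zero]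
  refine ⟨0, q / (k + 1) / ((N : ℚ) - 1) ^ (k + 1) - q / (k + 1) / (N : ℚ) ^ (k + 1),
    (RFun.const 0 : RFun 1).rep,
    (RFun.const (q / (k + 1) / ((N : ℚ) - 1) ^ (k + 1) - q / (k + 1) / (N : ℚ) ^ (k + 1)) :
      RFun 0).rep, rfl, fun x _ => ?_, rfl, fun x _ => ?_, ?_⟩
  · show (RFun.const 0 : RFun 1).fn x = ((0 : ℚ) : ℝ) / ((N : ℝ) - x 0)
    rw [RFun.fn_const, Rat.cast_zero, zero_div]
  · exact RFun.fn_const _ x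
  · have : KZ.of r - (KZ.of (RFun.const 0 : RFun 1).rep + KZ.of (RFun.const
          (q / (k + 1) / ((N : ℚ) - 1) ^ (k + 1) - q / (k + 1) / (N : ℚ) ^ (k + 1)) : RFun 0).rep) =
        (KZ.of r - KZ.of T.dlast.rep)
          + (KZ.of T.dlast.rep - (KZ.of (T.face 1 ⟨zero_le_one, le_rfl⟩).rep -
              KZ.of (T.face 0 ⟨le_rfl, zero_le_one⟩).rep))
          - (KZ.of ((T.face 1 ⟨zero_le_one, le_rfl⟩).sub (T.face 0 ⟨le_rfl, zero_le_one⟩)).rep -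
              (KZ.of (T.face 1 ⟨zero_le_one, le_rfl⟩).rep -
                KZ.of (T.face 0 ⟨le_rfl, zero_le_one⟩).rep))
          + (KZ.of ((T.face 1 ⟨zero_le_one, le_rfl⟩).sub (T.face 0 ⟨le_rfl, zero_le_one⟩)).rep -
              KZ.of (RFun.const (q / (k + 1) / ((N : ℚ) - 1) ^ (k + 1) -
                q / (k + 1) / (N : ℚ) ^ (k + 1)) : RFun 0).rep)
          - KZ.of (RFun.const 0 : RFun 1).rep := by abel
    rw [this]
    exact KZ.relations.sub_mem (KZ.relations.add_mem (KZ.relations.sub_mem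
      (KZ.relations.add_mem h1 hst) h2) h3) h4

/-! ## The stub -/

/-- **Stub `lineBase`** of line `Sketch` (Padé box island) of the crux `ReductionRigidity`: the
pure-power layer of the line reduction — for `N ≥ 2`, `q ∈ ℚ`, `m ∈ ℕ`, every representation
`[□¹, q/(N − x)^m]` is congruent modulo `KZ.relations` to `[□¹, β/(N − x)] + [pt, γ]` with
`β, γ ∈ ℚ` (`m = 0`: the constant, by ignoring the variable; `m = 1`: the normal form itself;
`m ≥ 2`: exact, by Newton–Leibniz with the rational primitive `q(N − x)^{1−m}/(m − 1)`).
[cite: KontsevichZagier2001, §1.2] -/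
theorem stub_lineBase : ∀ (N : ℕ), 2 ≤ N → ∀ (q : ℚ) (m : ℕ) (r : IntegralRep 1),
    r.domain = cube 1 → EqOn r.integrand (fun p => (q : ℝ) / ((N : ℝ) - p 0) ^ m) (cube 1) →
    ∃ (β γ : ℚ) (s₁ : IntegralRep 1) (s₀ : IntegralRep 0),
      s₁.domain = cube 1 ∧ EqOn s₁.integrand (fun p => (β : ℝ) / ((N : ℝ) - p 0)) (cube 1) ∧
      s₀.domain = cube 0 ∧ EqOn s₀.integrand (fun _ => (γ : ℝ)) (cube 0) ∧
      KZ.of r - (KZ.of s₁ + KZ.of s₀) ∈ KZ.relations := by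
  intro N hN q m r hrd hri
  rcases m with _ | _ | k
  · exact lineBase_pow_zero N q r hrd hri
  · exact lineBase_pow_one hN q r hrd hri
  · exact lineBase_pow_add_two hN q k r hrd hri

end Summit.KontsevichZagierPeriods.HermiteRigidity.ReductionRigidity

end
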